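import Summits.BirchSwinnertonDyer.Rank1Residual.X4.KuriharaLevelLoweringModPowTwist
import Summits.BirchSwinnertonDyer.Rank1Residual.X4.KimDefectLevelLoweringModPow
import HarnessLib

/-!
# The `ord_p ∏ c ≤ e + 1` closure of a TWIST-GOOD row from a certificate computed on its twist: K72 (transport) composed with K70 (the one-factor socket at `α = e`) (cell `b2b-bsdres`, seat additive-p4 gen 29, line V49)

HONEST FRAMING (cell `b2b-bsdres`, verbatim in every file): the goal of the cell is to DELETE the
COMBINATION-SHAPED residual classes for ALL analytic-rank `≤ 1` curves over `ℚ` — "full BSD formula for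
every rank `≤ 1` curve in class `C`" assembled STRICTLY from published theorems — so that the rank-`≤ 1`
remainder becomes exactly the CONSTRUCTION-SHAPED classes, which are TYPED (missing-input Props), NOT
attempted; this is not "finishing BSD". This file: research route on the CONSTRUCTION-shaped class X4;
X4 stays CONSTRUCTION-SHAPED; labels unchanged; nothing booked; no Literature fact minted; the `p ≥ 3`
statement is CONDITIONAL on the announced Kim 2025 clause; THEOREMS ONLY; `#print axioms` standard.

## What is here

ONE-STATEMENT ENDs for a twist-good row `W = V ⊗ χ` of the `ord_p ∏ c ≥ 3` residue: the inputs are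
(a) the ℚ-level twist identity of the plus symbol of `D.f` with a `V`-side symbol function `σ` and ONE
`p`-integral constant `c₀` (tree theorems `ModularForms.exists_rat_forall_ratPlusSymbol_charTwist_eq[_of_odd]`
+ period bookkeeping), (b) the mod-`p^e` `ℓ`-old identity of sign `w = a_ℓ(V)` for `\overline{σ}`
with a periodic `T_q`-eigen `μ` (the per-pair certificate computed by instrument E7 at the levels
`N_V`, `N_V/ℓ` — EVIDENCE), (c) the twist relation `a_q(W) = χ(q) a_q(V)` at the Kolyvagin primes and
`w χ(ℓ) = 1`, (d) `ord_p ∏_v c_v(W) ≤ e + 1`, `#Ш_an(W)` a `p`-unit, and the published inputs of the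
socket. Then `BSD(W, p)`: at `p ≥ 5` from PUBLISHED inputs (`…_of_five_le`; the census row 322050bt1
@ 5, `N = 322 050`, certified on its twist of conductor `12 882` at `ℓ = 2`, `e = 2 = ord₅ c₂`), at
`p ≥ 3` modulo Kim 2025 (`…_of_kim2025_OPEN`; 43 twist-good rows @ 3). PARITY (additive-p4 gen 31 audit):
`σ` must have the parity of `χ` — for an ODD character (`D < 0`) `σ` is the MINUS symbol of `f_V`
(tree: `exists_rat_forall_ratPlusSymbol_charTwist_eq_of_odd`), so the `V`-side certificate must be
computed on `V`'s MINUS modular-symbol space; gen 29's instrument E7 ran the PLUS space on every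
twist, which is the right parity only for EVEN `D` (e.g. 322050bt1, `D = 5`; 136710cd1/136710z1/
321930fd1, `D = 21`) and the wrong one for the odd rows (e.g. 369342cd1, `D = −51`: its conductor-`142`
run certifies the curve's MINUS symbol and is not an input here; table `PARITY-AUDIT.tsv` of the cell's
instrument record). Nothing booked; per pair; X4 CONSTRUCTION-SHAPED.

References: Kim 2026 [Kim2022StructureSelmer] Thm. 1.9 (6), Conj. 1.10; Kim 2025 [Kim2025RefinedTNC]
Thm. 1.1 (PREPRINT, reason only); Mazur–Tate–Teitelbaum 1986 §I.8 [MazurTateTeitelbaum1986Invent];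
Shimura 1971 Prop. 3.64 [Shimura1971]; Silverman AEC X.4.14 [SilvermanAEC2009]; Miller 2011 Def. 1.1
[Miller2011LMS].
-/

noncomputable section

open scoped Classical MatrixGroups ModularForm

open CongruenceSubgroup WeierstrassCurve Literature.NumberTheory.EllipticCurves
  Literature.NumberTheory.EllipticCurves.ModularForms
  Literature.NumberTheory.EllipticCurves.Rank1Residual
  Literature.NumberTheory.EllipticCurves.Rank1Residual.Typed
  Summit.BirchSwinnertonDyer.Rank1Residual.LevelLowering
  Summit.BirchSwinnertonDyer.Rank1Residual.Additive

open Literature.NumberTheory.DiophantineGeometry.Dioph (ratModP)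

namespace Summit.BirchSwinnertonDyer.Rank1Residual.X4

variable (W V : WeierstrassCurve ℚ) [W.IsElliptic] [W.IsGloballyMinimal] [V.IsGloballyMinimal]
  (p : ℕ) [hp : Fact p.Prime]

/-- **`BSD(W,p)` on a twist-good `ord_p ∏ c ≤ e + 1` unit row at `p ≥ 5`, from a certificate computed
on the twist `V`** (K72 `plusSymbolLevelLowersModAt_of_ratTwist` ∘ K70
`bsdp_of_plusSymbolLevelLowersModAt_of_tamagawa_le_succ_of_shaAn_unit_of_five_le`): PUBLISHED inputs
(Kim (6) `hKimk`/`hE67c`, Cassels–Tate, GZK, modularity), analytic rank `0`, `ρ̄_{W,p}` onto,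
conductor-level datum `D` of `W` with `p ∤ c_D` and the period transfer, `#Ш_an = q'` a `p`-unit; the
ℚ-level twist identity `[r]⁺_{D.f} = c₀ ∑_u ε(u) σ(r + u/m)` with `p ∤ den c₀`, `p`-integral `σ`,
`ε` reducing to `χ : ℤ/m →* ℤ/p^e`; the `V`-side mod-`p^e` identity `\overline{σ} = μ − w μ∘[ℓ]`
(`μ` periodic, `T_q μ = a_q(V) μ` at the Kolyvagin primes of `(W,p)`), `ℓ ∣ N_W` invertible mod `m`,
`χ(ℓ)² = 1`, `w χ(ℓ) = 1`, the twist relation `a_q(W) = χ(q) a_q(V)`; and `ord_p ∏_v c_v(W) ≤ e + 1`.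
Per pair; nothing booked. [cite: Kim2022StructureSelmer, Thm. 1.9 (6) and Conj. 1.10 (PDF p. 8)]
[cite: MazurTateTeitelbaum1986Invent, §I.8] [cite: SilvermanAEC2009, Thm. X.4.14] [cite: Miller2011LMS, §1 and Def. 1.1] -/
theorem bsdp_of_ratTwist_levelLowersModAt_of_tamagawa_le_succ_of_shaAn_unit_of_five_le
    (hKimk : Kim2026.rankZero_le_padicValNat_sha_of_kuriharaNumber_ne_zero)
    (hE67c : Kim2026.rankZero_padicValNat_sha_add_le_of_forall_pow_dvd_kuriharaNumber_cyclicLevel)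
    (hCT : exists_casselsTate_pairing (K := ℚ))
    (hGZK : rank_eq_analyticRank_of_analyticRank_le_one) (hmod : hasEntireLFunction_rat)
    (hp5 : 5 ≤ p) (hr : W.analyticRank = 0) (hsurj : W.HasSurjectiveModNGaloisRep p)
    {N : ℕ} [NeZero N] (D : ModularParametrizationData W N) (hN : W.conductorNorm ℤ = N)
    (hc : ¬ (p : ℤ) ∣ D.maninConstant)
    (hper : ∃ u : ℚ, ‖(u : ℚ_[p])‖ = 1 ∧ W.realPeriodRat = u * plusPeriod D.f)
    {q' : ℚ} (hq' : shaAn W = (q' : ℂ)) (hv : padicValRat p q' = 0)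
    {e : ℕ} {m : ℕ} [NeZero m] (χ : ZMod m →* ZMod (p ^ e)) (ε : ZMod m → ℤ)
    (hε : ∀ u : ZMod m, ((ε u : ℤ) : ZMod (p ^ e)) = χ u)
    (σ : ℚ → ℚ) (c₀ : ℚ) (hc₀ : ¬ p ∣ c₀.den) (hint : ∀ x : ℚ, ¬ p ∣ (σ x).den)
    (hsym : ∀ r : ℚ, ratPlusSymbol D.f r =
      c₀ * ∑ u : ZMod m, (ε u : ℚ) * σ (r + (u.val : ℚ) / m))
    {μ : ℚ → ZMod (p ^ e)} (hμ : IsPeriodic μ) {w : ZMod (p ^ e)} {ℓ : ℕ}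
    (hV : ∀ r : ℚ, ratModP (p ^ e) (σ r) = μ r - w * μ (ℓ * r))
    (hℓN : ℓ ∣ W.conductorNorm ℤ) (hℓ : IsUnit ((ℓ : ℕ) : ZMod m)) (hχℓ : χ ℓ ^ 2 = 1)
    (hw : w * χ ℓ = 1)
    (hHV : ∀ q : ℕ, Kato.IsKolyvaginPrime W p 1 q → HeckeRel μ q (V.frobeniusTrace q : ZMod (p ^ e)))
    (hunit : ∀ q : ℕ, Kato.IsKolyvaginPrime W p 1 q → IsUnit ((q : ℕ) : ZMod m) ∧ χ q ^ 2 = 1)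
    (haq : ∀ q : ℕ, Kato.IsKolyvaginPrime W p 1 q →
      (W.frobeniusTrace q : ZMod (p ^ e)) = χ q * V.frobeniusTrace q)
    (hce : padicValNat p W.tamagawaProduct ≤ e + 1) : BSDp W p :=
  bsdp_of_plusSymbolLevelLowersModAt_of_tamagawa_le_succ_of_shaAn_unit_of_five_le W p hKimk hE67c hCT
    hGZK hmod hp5 hr hsurj D hN hc hper hq' hv
    (plusSymbolLevelLowersModAt_of_ratTwist W V χ ε hε D.f σ c₀ hc₀ hint hsym hμ hV hℓ hχℓ hw hHV
      hunit haq) hℓN hce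

/-- **The `p ≥ 3` tower twin, CONDITIONAL on the announced Kim 2025 clause** (`hK25s`): `BSD(W,p)` on
a twist-good unit tower row with `ord_p ∏_v c_v(W) ≤ e + 1` from a mod-`p^e` certificate computed on
the twist `V` IN THE PARITY OF `χ` (minus space of `V` for odd `χ_D`, `D < 0`; see the module
docstring) — the 43 twist-good `ord₃ ∏ c ≥ 3` rows of N11 (e.g. 369342cd1, `ℓ = 2`, `c₂ = 27`,
`−51`-twist of conductor `142`: gen 29's plus-space run there has the wrong parity). Per pair;
nothing booked.
[claim: Kim2025RefinedTNC, status: under-review]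
[cite: Kim2025RefinedTNC, Thm. 1.1 ("BSD") (ANNOUNCED, OPEN binder)] [cite: Kim2022StructureSelmer, Conj. 1.10 (PDF p. 8)]
[cite: MazurTateTeitelbaum1986Invent, §I.8] [cite: SilvermanAEC2009, Thm. X.4.14] -/
theorem bsdp_of_ratTwist_levelLowersModAt_of_tamagawa_le_succ_of_shaAn_unit_of_kim2025_OPEN
    (hK25s : Kim2025.thm11_kimShaLength_of_integralPeriod_OPEN)
    (hCT : exists_casselsTate_pairing (K := ℚ))
    (hGZK : rank_eq_analyticRank_of_analyticRank_le_one) (hmod : hasEntireLFunction_rat)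
    (hp3 : 3 ≤ p) (hr : W.analyticRank = 0) (htower : ∀ n : ℕ, W.HasSurjectiveModNGaloisRep (p ^ n : ℕ))
    {N : ℕ} [NeZero N] (D : ModularParametrizationData W N) (hN : W.conductorNorm ℤ = N)
    (hper : ∃ u : ℚ, ‖(u : ℚ_[p])‖ = 1 ∧ W.realPeriodRat = u * plusPeriod D.f)
    {q' : ℚ} (hq' : shaAn W = (q' : ℂ)) (hv : padicValRat p q' = 0)
    {e : ℕ} {m : ℕ} [NeZero m] (χ : ZMod m →* ZMod (p ^ e)) (ε : ZMod m → ℤ)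
    (hε : ∀ u : ZMod m, ((ε u : ℤ) : ZMod (p ^ e)) = χ u)
    (σ : ℚ → ℚ) (c₀ : ℚ) (hc₀ : ¬ p ∣ c₀.den) (hint : ∀ x : ℚ, ¬ p ∣ (σ x).den)
    (hsym : ∀ r : ℚ, ratPlusSymbol D.f r =
      c₀ * ∑ u : ZMod m, (ε u : ℚ) * σ (r + (u.val : ℚ) / m))
    {μ : ℚ → ZMod (p ^ e)} (hμ : IsPeriodic μ) {w : ZMod (p ^ e)} {ℓ : ℕ}
    (hV : ∀ r : ℚ, ratModP (p ^ e) (σ r) = μ r - w * μ (ℓ * r))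
    (hℓN : ℓ ∣ W.conductorNorm ℤ) (hℓ : IsUnit ((ℓ : ℕ) : ZMod m)) (hχℓ : χ ℓ ^ 2 = 1)
    (hw : w * χ ℓ = 1)
    (hHV : ∀ q : ℕ, Kato.IsKolyvaginPrime W p 1 q → HeckeRel μ q (V.frobeniusTrace q : ZMod (p ^ e)))
    (hunit : ∀ q : ℕ, Kato.IsKolyvaginPrime W p 1 q → IsUnit ((q : ℕ) : ZMod m) ∧ χ q ^ 2 = 1)
    (haq : ∀ q : ℕ, Kato.IsKolyvaginPrime W p 1 q →
      (W.frobeniusTrace q : ZMod (p ^ e)) = χ q * V.frobeniusTrace q)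
    (hce : padicValNat p W.tamagawaProduct ≤ e + 1) : BSDp W p :=
  bsdp_of_plusSymbolLevelLowersModAt_of_tamagawa_le_succ_of_shaAn_unit_of_kim2025_OPEN W p hK25s hCT
    hGZK hmod hp3 hr htower D hN hper hq' hv
    (plusSymbolLevelLowersModAt_of_ratTwist W V χ ε hε D.f σ c₀ hc₀ hint hsym hμ hV hℓ hχℓ hw hHV
      hunit haq) hℓN hce

end Summit.BirchSwinnertonDyer.Rank1Residual.X4

end
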